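import Literature.NumberTheory.FaltingsSerre.S6Subgroups
import Literature.NumberTheory.FaltingsSerre.GSp4F2Iso
import HarnessLib

/-!
# The Faltings–Serre method after Brumer–Pacetti–Poor–Tornaría–Voight–Yuen, X:
# the residual image from a transvection and an element of order `5` — `S₅(b)` or `S₆`, hence
# absolutely irreducible (the `absIrreducible` field of the certificate, discharged in the kernel)

[BPPTVY] = A. Brumer, A. Pacetti, C. Poor, G. Tornaría, J. Voight, D. S. Yuen, *On the paramodularity of
typical abelian surfaces*, Algebra & Number Theory **13**:5 (2019) 1145–1195 [cite: BrumerEtAl2019]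
(PRINTED numbering).

The residual step of the cell's certificates ("Route T", `certs/<N>/residual/residual.json`,
N = 349, 461) establishes, for `σ = ρ̄_{A,2}` or `ρ̄_{f,2} : Γ → GSp₄(𝔽₂) = Sp₄(𝔽₂)`:
(P1) some `σ(Frob_p)` has characteristic polynomial `Φ₅ = X⁴+X³+X²+X+1 (mod 2)` (so order `5`,
[BPPTVY, Lemma 5.1.5 p. 1173]); (P2) the image contains a transvection (inertia at the prime `N ∥ N`,
[BPPTVY, Lemma 4.3.10 p. 1172, proof of Prop. 5.2.4 p. 1175; Lemma 5.2.1 p. 1174]).  THIS FILE draws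
the conclusion in the kernel (standard axioms), through `ι : S₆ ≅ Sp₄(𝔽₂)` (`GSp4F2.iotaMulEquiv`) and
the group theory of `S6Subgroups.lean`:

* `GSp4F2.range_eq_S6_or_S5b` — the image is `ι(S₆)` or `ι(Stab(x))` (`= S₅(b)` up to conjugacy,
  [BPPTVY, Example 5.1.9 p. 1174]);
* `GSp4F2.isAbsIrreducible_of_transvection_of_orderFive` — hence `σ` is absolutely irreducible
  ([BPPTVY, Lemma 5.1.7 / Lemma 5.2.1 p. 1174]; via `isAbsIrreducible_of_S5b`, `isAbsIrreducible_of_S6`);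
* `GSp4F2.isAbsIrreducible_of_transvection_of_charpoly` — the same with (P1) given as the
  characteristic polynomial `Φ₅` (Cayley–Hamilton ⇒ `c⁵ = 1`, `c ≠ 1`) and the symplectic condition
  `σ(γ)ᵀ J σ(γ) = J` in place of `range σ ≤ range ι` (`GSp4F2.mem_range_iotaGL`).

This is the form in which the pipeline seats discharge `Certificate.absIrreducible`
(`FaltingsSerre/ParamodularCertificate.lean`) for an image determined by Route T.

## References
* [BPPTVY] ANT 13:5 (2019): Lemma 5.1.5 p. 1173, Lemma 5.1.7 / Example 5.1.9 / Lemma 5.2.1 p. 1174,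
  Lemma 4.3.10 p. 1172, Prop. 5.2.4 p. 1175. [cite: BrumerEtAl2019]
-/

namespace Literature.NumberTheory.FaltingsSerre.GSp4F2

open Matrix Equiv Equiv.Perm Polynomial Literature.NumberTheory.GaloisRepresentations

/-- Pull-back to `S₆` of a subgroup `H ≤ ι(S₆) = Sp₄(𝔽₂)`: `ι` maps `ι⁻¹(H)` onto `H`. [cite: BrumerEtAl2019, (5.1.1) p. 1173] -/
theorem map_comap_iotaGL {H : Subgroup (GL (Fin 4) (ZMod 2))} (hH : H ≤ iotaGL.range) :
    (H.comap iotaGL).map iotaGL = H :=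
  Subgroup.map_comap_eq_self hH

/-- **Image classification (Route T).** If the image of `σ : Γ → Sp₄(𝔽₂) = ι(S₆)` contains a
transvection and an element of order `5`, then it is `ι(S₆)` or `ι(Stab(x))` for some letter `x`
(a point stabilizer, `≅ S₅`, the class `S₅(b)` of [BPPTVY, Lemma 5.1.7]). [cite: BrumerEtAl2019, Example 5.1.9 p. 1174] -/
theorem range_eq_S6_or_S5b {Γ : Type*} [Group Γ] (σ : Γ →* GL (Fin 4) (ZMod 2))
    (hSp : σ.range ≤ iotaGL.range)
    {t : GL (Fin 4) (ZMod 2)} (ht : IsTransvection (t : Matrix (Fin 4) (Fin 4) (ZMod 2)))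
    (htσ : t ∈ σ.range)
    {c : GL (Fin 4) (ZMod 2)} (hc5 : c ^ 5 = 1) (hc1 : c ≠ 1) (hcσ : c ∈ σ.range) :
    σ.range = iotaGL.range ∨
      ∃ x : Fin 6, σ.range = (MulAction.stabilizer (Perm (Fin 6)) x).map iotaGL := by
  set G : Subgroup (Perm (Fin 6)) := σ.range.comap iotaGL with hGdef
  have hGH : G.map iotaGL = σ.range := map_comap_iotaGL hSp
  -- the transvection is `ι` of a transposition lying in `G`
  obtain ⟨τ, hτ⟩ := hSp htσ
  have hτswap : τ.IsSwap := by
    rw [← isTransvection_iota_iff, ← coe_iotaGL, hτ]; exact ht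
  have hτG : τ ∈ G := by rw [hGdef, Subgroup.mem_comap, hτ]; exact htσ
  obtain ⟨a, b, hab, rfl⟩ := hτswap
  -- the element of order 5 is `ι` of an element of order 5 lying in `G`
  obtain ⟨γ, hγ⟩ := hSp hcσ
  have hγ5 : γ ^ 5 = 1 := iotaGL_injective (by rw [map_pow, hγ, hc5, map_one])
  have hγ1 : γ ≠ 1 := fun h => hc1 (by rw [← hγ, h, map_one])
  have hγG : γ ∈ G := by rw [hGdef, Subgroup.mem_comap, hγ]; exact hcσ
  rcases eq_stabilizer_or_top_of_swap_mem_of_orderFive_mem G hab hτG hγ5 hγ1 hγG with ⟨x, hx⟩ | htop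
  · right
    exact ⟨x, by rw [← hGH, hx]⟩
  · left
    rw [← hGH, htop, ← MonoidHom.range_eq_map]

/-- **Absolute irreducibility from Route T.** If the image of `σ : Γ → Sp₄(𝔽₂) = ι(S₆)` contains a
transvection and an element of order `5`, then `σ` is absolutely irreducible (its image is `S₅(b)` or
`S₆`, both absolutely irreducible by [BPPTVY, Lemma 5.1.7]; kernel proofs `isAbsIrreducible_of_S5b`,
`isAbsIrreducible_of_S6`). [cite: BrumerEtAl2019, Lemma 5.1.7, Lemma 5.2.1 p. 1174] -/
theorem isAbsIrreducible_of_transvection_of_orderFive {Γ : Type*} [Group Γ]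
    (σ : Γ →* GL (Fin 4) (ZMod 2)) (hSp : σ.range ≤ iotaGL.range)
    {t : GL (Fin 4) (ZMod 2)} (ht : IsTransvection (t : Matrix (Fin 4) (Fin 4) (ZMod 2)))
    (htσ : t ∈ σ.range)
    {c : GL (Fin 4) (ZMod 2)} (hc5 : c ^ 5 = 1) (hc1 : c ≠ 1) (hcσ : c ∈ σ.range) :
    IsAbsIrreducible σ := by
  rcases range_eq_S6_or_S5b σ hSp ht htσ hc5 hc1 hcσ with hS6 | ⟨x, hx⟩
  · refine isAbsIrreducible_of_S6 σ 1 ?_ ?_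
    all_goals
      rw [one_mul, inv_one, mul_one, hS6]
      exact ⟨_, rfl⟩
  · -- `Stab(x) = g · Stab(6) · g⁻¹` with `g = (6 x)`; conjugate the printed generators of `S₅(b)`
    set g : Perm (Fin 6) := swap 5 x with hgdef
    have hg5 : g 5 = x := by rw [hgdef, swap_apply_left]
    have hgx : g⁻¹ x = 5 := by rw [Perm.inv_eq_iff_eq, hg5]
    have hconj : ∀ s : Perm (Fin 6), s 5 = 5 →
        iotaGL g * iotaGL s * (iotaGL g)⁻¹ ∈ σ.range := by
      intro s hs
      rw [← map_mul, ← map_inv, ← map_mul, hx]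
      refine Subgroup.mem_map_of_mem _ ?_
      rw [MulAction.mem_stabilizer_iff, Perm.smul_def, Perm.mul_apply, Perm.mul_apply, hgx, hs, hg5]
    exact isAbsIrreducible_of_S5b σ (iotaGL g) (hconj c12345 (by decide)) (hconj t12 (by decide))
      (hconj c123 (by decide))

/-- An element of `GL₄(𝔽₂)` with characteristic polynomial `Φ₅ = X⁴+X³+X²+X+1` has order `5`
(Cayley–Hamilton: `c⁴+c³+c²+c+1 = 0`, so `c⁵ = 1`; and `c ≠ 1` since `5 ≠ 0` in `M₄(𝔽₂)`) — the
order-`5` row of [BPPTVY, Lemma 5.1.5]. [cite: BrumerEtAl2019, Lemma 5.1.5 p. 1173] -/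
theorem pow_five_eq_one_of_charpoly (c : GL (Fin 4) (ZMod 2))
    (hchar : (c : Matrix (Fin 4) (Fin 4) (ZMod 2)).charpoly = X ^ 4 + X ^ 3 + X ^ 2 + X + 1) :
    c ^ 5 = 1 ∧ c ≠ 1 := by
  have hCH := Matrix.aeval_self_charpoly (c : Matrix (Fin 4) (Fin 4) (ZMod 2))
  rw [hchar] at hCH
  simp only [map_add, map_pow, aeval_X, map_one] at hCH
  -- hCH : c^4 + c^3 + c^2 + c + 1 = 0  (as matrices)
  have hgeom : (c : Matrix (Fin 4) (Fin 4) (ZMod 2)) ^ 5 - 1 = 0 := by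
    rw [← geom_sum_mul (c : Matrix (Fin 4) (Fin 4) (ZMod 2)) 5]
    have : (∑ i ∈ Finset.range 5, (c : Matrix (Fin 4) (Fin 4) (ZMod 2)) ^ i)
        = (c : Matrix (Fin 4) (Fin 4) (ZMod 2)) ^ 4 + (c : Matrix _ _ _) ^ 3
          + (c : Matrix _ _ _) ^ 2 + (c : Matrix _ _ _) + 1 := by
      simp only [Finset.sum_range_succ, Finset.sum_range_zero, pow_zero, pow_one, zero_add]
      abel
    rw [this, hCH, zero_mul]
  refine ⟨?_, ?_⟩
  · apply Units.ext
    rw [Units.val_pow_eq_pow_val, Units.val_one]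
    exact sub_eq_zero.mp hgeom
  · intro h1
    rw [h1] at hCH
    simp only [Units.val_one, one_pow] at hCH
    -- hCH : 1 + 1 + 1 + 1 + 1 = 0 in M₄(𝔽₂)
    have h00 := congrFun (congrFun hCH 0) 0
    revert h00
    simp only [Matrix.add_apply, Matrix.one_apply_eq, Matrix.zero_apply]
    decide

/-- **Absolute irreducibility from Route T, certificate form.** `σ : Γ → GL₄(𝔽₂)` with symplectic
image (`σ(γ)ᵀ J σ(γ) = J` for all `γ`: `GSp₄(𝔽₂) = Sp₄(𝔽₂)`), containing a transvection (`σ(i)`,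
`i` a generator of inertia at `p ∥ N`) and an element with characteristic polynomial `Φ₅ (mod 2)`
(`σ(Frob_p)` with `Q_p(f,x) ≡ x⁴+x³+x²+x+1`), is absolutely irreducible — the hypothesis
"`ρ̄` absolutely irreducible" of the criterion [BPPTVY, Thm 2.1.5], i.e. the certificate field
`Certificate.absIrreducible`, for images determined by Route T. [cite: BrumerEtAl2019, Lemma 5.1.7, Lemma 5.2.1 p. 1174] -/
theorem isAbsIrreducible_of_transvection_of_charpoly {Γ : Type*} [Group Γ]
    (σ : Γ →* GL (Fin 4) (ZMod 2))
    (hsymp : ∀ γ : Γ, ((σ γ : GL (Fin 4) (ZMod 2)) : Matrix (Fin 4) (Fin 4) (ZMod 2))ᵀ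
        * antiId4 (ZMod 2) * (σ γ : Matrix (Fin 4) (Fin 4) (ZMod 2)) = antiId4 (ZMod 2))
    (i : Γ) (hi : IsTransvection ((σ i : GL (Fin 4) (ZMod 2)) : Matrix (Fin 4) (Fin 4) (ZMod 2)))
    (φ : Γ) (hφ : ((σ φ : GL (Fin 4) (ZMod 2)) : Matrix (Fin 4) (Fin 4) (ZMod 2)).charpoly
        = X ^ 4 + X ^ 3 + X ^ 2 + X + 1) :
    IsAbsIrreducible σ := by
  have hSp : σ.range ≤ iotaGL.range := by
    rintro _ ⟨γ, rfl⟩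
    rw [mem_range_iotaGL]
    exact hsymp γ
  obtain ⟨h5, h1⟩ := pow_five_eq_one_of_charpoly (σ φ) hφ
  exact isAbsIrreducible_of_transvection_of_orderFive σ hSp hi ⟨i, rfl⟩ h5 h1 ⟨φ, rfl⟩

end Literature.NumberTheory.FaltingsSerre.GSp4F2
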